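import Mathlib
import Summits.ValiantsHypothesis.ValiantsHypothesis.Theorems.FifoMatchingNNDivisionHardFewFlatsExpRate
import Summits.ValiantsHypothesis.ValiantsHypothesis.Theorems.FifoMatchingNNNotVPDivisionSplitDefs
import HarnessLib

/-!
# Crux `Theses.FifoMatching.NNNotVP` (stmt-ValiantsHypothesis-11615), line `division_split`, stub B2
# `stub_spreadCofactorReduction` ≡ EXPONENTIAL DIVISION HARDNESS OF `NN` (✓ `…NNNotVPSpreadCofactorIffExpHard`):
# the exponential law HOLDS on the PARALLEL-FLATS class of cofactors — in particular on the products `p · q` of a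
# few-nomial and a low-dimensional factor (any degrees), a class neither the count tier nor the dimension tier decides

By ✓ `spreadCofactorReduction_iff_expDivisionHard` the registered open stub B2 of line `division_split` is, verbatim,
`∃ r n₀, ∀ n ≥ n₀, ∀ h ≠ 0, n ≤ (log₂ (L₊(NN_n · h) + L₊(h)))^r`.  ✓ `…NNNotVPExpDivisionHardFewMonomials.expDivisionHard_fewMonomials`
(leafhand-8-g1) records the instance `|supp h| ≤ 2^{κ√n}`.  This file records the instance decided by the PARALLEL-FLATS RUNG
(✓ `…NNDivisionHardFewFlatsExpRate.nn_complexity_expLowerBound_fewFlats` / `_mul`: `2^{κ√n} ≤ L₊(NN_n · h)`), exponent `r = 3`: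

* `le_log_pow_three_of_exp` — the arithmetic: `2^{κ√n} ≤ a ≤ M` ⇒ `n ≤ (log₂ M)^3`, eventually in `n` (8-g1's computation, once).
* ★ `expDivisionHard_fewFlats` — for every `h ≠ 0` whose Newton polytope is generated by points on `≤ 2^{κ√n}` parallel translates of a
  direction space of dimension `≤ κ√n`: `n ≤ (log₂ (L₊(NN_n · h) + L₊(h)))^3`.
* ★ `expDivisionHard_mul_fewMonomials_lowdim` — for every product `h = p · q ≠ 0` with `|supp p| ≤ 2^{κ√n}`, `dim aff supp q ≤ κ√n`:
  `n ≤ (log₂ (L₊(NN_n · (p·q)) + L₊(p·q)))^3` (B2's right-hand side restricted to the class, in the `NN n` / `σ n` spelling).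

HONEST FRAMING: B2 (all cofactors) stays OPEN (≡ exponential `NNDivisionHard`, HY21 §6 Problem 2 at exponential rate); Z =
`ZeroOneTransfer` OPEN; `NNNotVP` OPEN; `VP ≠ VNP` NOT proved.  No definitions, no named facts, no sorry.
-/

set_option autoImplicit false

-- the mandated summit-side namespace repeats a component by design (single-problem summit)
set_option linter.dupNamespace false

noncomputable section

namespace Summit.ValiantsHypothesis.ValiantsHypothesis.Theorems.FifoMatching

namespace FewFlats

open MvPolynomial
open scoped NNReal
open Literature.Computability.AlgebraicComplexity (complexity nestFreeMatchingPoly)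
open Literature.Algebra.Polynomial.NewtonPolytope (newtonPolytope)
open Summit.ValiantsHypothesis.ValiantsHypothesis.Theorems.FifoMatching.NNNotVP.DivisionSplit (σ NN)
open Summit.ValiantsHypothesis.ValiantsHypothesis.Theorems.FifoMatching.QueueGridFace (suppPts)
open Summit.ValiantsHypothesis.ValiantsHypothesis.Theorems.FifoMatching.LowDim (adim)

/-- the arithmetic of the exponential law: for `κ > 0`, eventually in `n`, `2^{κ√n} ≤ a ≤ M` forces `n ≤ (log₂ M)^3`
(`κ√n < log₂ M + 1`, and `(κ√n/2)^3 ≥ n` once `κ³√n ≥ 8`, `κ√n ≥ 2`). [folklore] -/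
theorem le_log_pow_three_of_exp {κ : ℝ} (hκ : 0 < κ) : ∃ N : ℕ, ∀ n ≥ N, ∀ (a M : ℕ),
    (2 : ℝ) ^ (κ * Real.sqrt n) ≤ (a : ℝ) → a ≤ M → n ≤ (Nat.log 2 M) ^ 3 := by
  obtain ⟨N, hN⟩ := exists_nat_ge ((8 / κ ^ 3) ^ 2 + (2 / κ) ^ 2)
  refine ⟨N, fun n hn a M hL haM => ?_⟩
  have hnN : ((8 / κ ^ 3) ^ 2 + (2 / κ) ^ 2 : ℝ) ≤ n := hN.trans (by exact_mod_cast hn)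
  set t : ℕ := Nat.log 2 M with ht
  have hLM : (a : ℝ) ≤ M := by exact_mod_cast haM
  have hMt : (M : ℝ) < (2 : ℝ) ^ ((t : ℝ) + 1) := by
    have h1 : M < 2 ^ (t + 1) := Nat.lt_pow_succ_log_self (by norm_num) M
    have h2 : (M : ℝ) < (2 : ℝ) ^ (t + 1) := by exact_mod_cast h1
    have h3 : (2 : ℝ) ^ ((t : ℝ) + 1) = (2 : ℝ) ^ (t + 1) := by
      rw [show ((t : ℝ) + 1) = ((t + 1 : ℕ) : ℝ) by push_cast; ring, Real.rpow_natCast]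
    rw [h3]; exact h2
  have hlt : κ * Real.sqrt n < (t : ℝ) + 1 := by
    have := lt_of_le_of_lt (hL.trans hLM) hMt
    exact (Real.rpow_lt_rpow_left_iff (by norm_num : (1 : ℝ) < 2)).1 this
  have hsq1 : 8 / κ ^ 3 ≤ Real.sqrt n := by
    rw [show (8 / κ ^ 3 : ℝ) = Real.sqrt ((8 / κ ^ 3) ^ 2) by rw [Real.sqrt_sq (by positivity)]]
    exact Real.sqrt_le_sqrt (by nlinarith [sq_nonneg (2 / κ)])
  have hsq2 : 2 / κ ≤ Real.sqrt n := by
    rw [show (2 / κ : ℝ) = Real.sqrt ((2 / κ) ^ 2) by rw [Real.sqrt_sq (by positivity)]]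
    exact Real.sqrt_le_sqrt (by nlinarith [sq_nonneg (8 / κ ^ 3)])
  have hx2 : 2 ≤ κ * Real.sqrt n := by
    have := mul_le_mul_of_nonneg_left hsq2 hκ.le
    rwa [show κ * (2 / κ) = 2 by field_simp] at this
  have hx8 : 8 / κ ^ 2 ≤ κ * Real.sqrt n := by
    have := mul_le_mul_of_nonneg_left hsq1 hκ.le
    rwa [show κ * (8 / κ ^ 3) = 8 / κ ^ 2 by field_simp] at this
  have htx : κ * Real.sqrt n / 2 ≤ (t : ℝ) := by linarith
  have hsqn : Real.sqrt n * Real.sqrt n = n := Real.mul_self_sqrt (Nat.cast_nonneg n)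
  have hkey : (n : ℝ) ≤ (t : ℝ) ^ 3 := by
    have hcube : (κ * Real.sqrt n / 2) ^ 3 ≤ (t : ℝ) ^ 3 :=
      pow_le_pow_left₀ (by positivity) htx 3
    have hk3 : (8 : ℝ) ≤ κ ^ 3 * Real.sqrt n := by
      have := mul_le_mul_of_nonneg_left hx8 (show (0 : ℝ) ≤ κ ^ 2 by positivity)
      rw [show κ ^ 2 * (8 / κ ^ 2) = 8 by field_simp] at this
      nlinarith
    have hs3 : Real.sqrt n ^ 3 = Real.sqrt n * n := by rw [pow_three, hsqn]
    have hexpand : (κ * Real.sqrt n / 2) ^ 3 = (κ ^ 3 * Real.sqrt n / 8) * n := by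
      rw [show (κ * Real.sqrt n / 2) ^ 3 = κ ^ 3 * Real.sqrt n ^ 3 / 8 by ring, hs3]; ring
    have hge : (n : ℝ) ≤ (κ * Real.sqrt n / 2) ^ 3 := by
      rw [hexpand]
      have hn0 : (0 : ℝ) ≤ n := Nat.cast_nonneg n
      nlinarith
    exact hge.trans hcube
  exact_mod_cast hkey

/-- `L₊(NN_n · h) ≤ L₊(NN_n · h) + L₊(h)` in the `NN n` spelling. -/
theorem complexity_le_sum {n : ℕ} (h : MvPolynomial (σ n) ℝ≥0) :
    complexity (nestFreeMatchingPoly n ℝ≥0 * h) ≤ complexity (NN n * h) + complexity h :=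
  Nat.le_add_right _ _

/-- ★ **B2's EXPONENTIAL LAW ON THE PARALLEL-FLATS CLASS (PROVED):** `∃ κ > 0, ∃ n₀, ∀ n ≥ n₀`, every `h ≠ 0` whose Newton polytope
is the hull of a family `q₀` labelled by `π : J → T`, `|T| ≤ 2^{κ√n}`, with equal-label differences in a space `V`, `dim V ≤ κ√n`,
satisfies `n ≤ (log₂ (L₊(NN_n · h) + L₊(h)))^3`. [cite: HrubesYehudayoff2021, §6 Problem 2] -/
theorem expDivisionHard_fewFlats : ∃ κ : ℝ, 0 < κ ∧ ∃ n₀ : ℕ, ∀ n ≥ n₀,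
    ∀ h : MvPolynomial (σ n) ℝ≥0, h ≠ 0 →
      ∀ {J T : Type} [Fintype J] [Nonempty J] [Fintype T] (q₀ : J → σ n → ℝ) (π : J → T)
        (V : Submodule ℝ (σ n → ℝ)),
        newtonPolytope (MvPolynomial.map NNReal.toRealHom h) = convexHull ℝ (Set.range q₀) →
        (∀ j j', π j = π j' → q₀ j - q₀ j' ∈ V) →
        (Fintype.card T : ℝ) ≤ (2 : ℝ) ^ (κ * Real.sqrt n) → (Module.finrank ℝ ↥V : ℝ) ≤ κ * Real.sqrt n →
          n ≤ (Nat.log 2 (complexity (NN n * h) + complexity h)) ^ 3 := by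
  obtain ⟨κ, hκ, n₁, H⟩ := nn_complexity_expLowerBound_fewFlats
  obtain ⟨N, hN⟩ := le_log_pow_three_of_exp hκ
  refine ⟨κ, hκ, max n₁ N, fun n hn h hh J T _ _ _ q₀ π V hQ hV hcard hdim => ?_⟩
  exact hN n (le_trans (le_max_right _ _) hn) _ _
    (H n (le_trans (le_max_left _ _) hn) h hh q₀ π V hQ hV hcard hdim) (complexity_le_sum h)

/-- ★ **B2's EXPONENTIAL LAW ON PRODUCTS OF A FEW-NOMIAL AND A LOW-DIMENSIONAL COFACTOR (PROVED):** `∃ κ > 0, ∃ n₀, ∀ n ≥ n₀`, every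
product `p · q ≠ 0` over `ℝ≥0` with `|supp p| ≤ 2^{κ√n}` and `dim aff supp q ≤ κ√n` satisfies
`n ≤ (log₂ (L₊(NN_n · (p·q)) + L₊(p·q)))^3` — any degrees of either factor. [cite: HrubesYehudayoff2021, §6 Problem 2] -/
theorem expDivisionHard_mul_fewMonomials_lowdim : ∃ κ : ℝ, 0 < κ ∧ ∃ n₀ : ℕ, ∀ n ≥ n₀,
    ∀ p q : MvPolynomial (σ n) ℝ≥0, p * q ≠ 0 →
      (p.support.card : ℝ) ≤ (2 : ℝ) ^ (κ * Real.sqrt n) → (adim (suppPts q) : ℝ) ≤ κ * Real.sqrt n →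
        n ≤ (Nat.log 2 (complexity (NN n * (p * q)) + complexity (p * q))) ^ 3 := by
  obtain ⟨κ, hκ, n₁, H⟩ := nn_complexity_expLowerBound_mul
  obtain ⟨N, hN⟩ := le_log_pow_three_of_exp hκ
  refine ⟨κ, hκ, max n₁ N, fun n hn p q hpq hcard hdim => ?_⟩
  exact hN n (le_trans (le_max_right _ _) hn) _ _
    (H n (le_trans (le_max_left _ _) hn) p q hpq hcard hdim) (complexity_le_sum (p * q))

end FewFlats

end Summit.ValiantsHypothesis.ValiantsHypothesis.Theorems.FifoMatching

end
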